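import Literature.AnabelianGeometry.EtaleTheta.Discharge.Sec2DtpYThetaAbelian
import Literature.AnabelianGeometry.EtaleTheta.Discharge.Sec2ThetaGroupCommutators
import Literature.AnabelianGeometry.EtaleTheta.Discharge.Sec1FreeTwoHeisenbergZHat
import Mathlib.Topology.Instances.ZMod
import HarnessLib

/-!
# [EtTh] §1 pp. 12–13: "`(Δ^tp_Y)^ell ≅ Ẑ(1)`" — the tempered `(Δ^tp_Y)^ell` of the §1 theta setting IS
# `Ẑ`, via the commutator pairing with a generator of `Z` (proof-only)

Mochizuki, *The étale theta function and its Frobenioid-theoretic manifestations*, Publ. RIMS **45**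
(2009) [EtTh], §1, PRIMS PDF pp. 12–13 (printed 238–239): "we have a natural exact sequence of abelian
profinite groups `1 → Δ_Θ → (Δ^tp_Y)^Θ → (Δ^tp_Y)^ell → 1`", "`(Δ^tp_Y)^ell ≅ Ẑ(1)`" (p. 13), and the
bilinear commutator map of [IUTchII] Rmk. 1.1.1 (iii) "`[-,-] : (Δ_X/Δ_Y) × Δ^ell_Y → Δ_Θ`"
[cite: MochizukiEtTh2009, §1 p.12] [cite: MochizukiEtTh2009, §1 p.13].
Layer L2 of the abc-iut cell, seat abc-iut-w5-d006 (gen 3); PROOF-ONLY (no definition, no named fact,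
nothing of another seat edited or restated).  The statement is one of the DEFERRED TRANSCRIPTIONS listed in
the header of the root file `Setting.lean` (abc-iut-L2-t1) and is the `kerEll`/`deltaEll_iso` input of
[IUTchII] Rmk. 1.1.1 (i) (`Literature.IUT.HodgeArakelov.CoreTower`, NV-L6 item (ii)).

WHAT IS PROVED, for `D : ThetaSetting p` with `Δ_X = D.DeltaHat ≤ Π_X = D.PiHat`, `K₂ = [Δ_X,Δ_X]⁻`,
`K₃ = [[Δ_X,Δ_X],Δ_X]⁻`, `ι = toHat : Π^tp_X → Π_X`, under the vacuity guard `hO : D.IsEtThOrigin`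
("`Δ_X` is a profinite free group on 2 generators", p. 12):
* `ThetaSetting.IsEtThOrigin.toHat_mem_commutatorClosure_of_commutator_mem` — NON-DEGENERACY OF THE
  COMMUTATOR PAIRING: for `σ ∈ Δ^tp_X` with `toZ σ = 1` and `y ∈ Δ^tp_Y`, if `[ι σ, ι y] ∈ K₃` then
  `ι y ∈ K₂` (i.e. `y` dies in `(Π^tp_X)^ell`);
* `ThetaSetting.IsEtThOrigin.exists_hom_dtpY_zHat` — under, additionally, EXACTLY the closedness binder
  `hYcl` of GAP-LEDGER row G-w4d021-2 (the hypothesis of abc-iut-L2-d1's `nonempty_deltaTheta_mulEquiv_zHat`):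
  a SURJECTIVE homomorphism `Λ : Δ^tp_Y → Ẑ` whose kernel is exactly `Δ^tp_Y ∩ Ker(Π^tp_X ↠ (Π^tp_X)^ell)`,
  namely `y ↦ φ[ι σ, ι y]` for abc-iut-w5-d171's `φ : K₂ ↠ Ẑ` (kernel `K₃`);
* `…nonempty_dtpY_quotient_mulEquiv_zHat` — `Δ^tp_Y/(Δ^tp_Y ∩ Ker(·)^ell) ≃* Ẑ` (the `CoreTower.deltaEll_iso`
  shape), and `…nonempty_dtpYEll_mulEquiv_zHat` — the printed object `(Δ^tp_Y)^ell := image of Δ^tp_Y in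
  (Π^tp_X)^ell` is `≃* Ẑ`.
Here `Ẑ = SemiGraphs.ZHat` (Mathlib's profinite completion of `ℤ`, `= IUT.HodgeTheaters.ZHat` by `rfl`).

PROOF.  SURJECTIVITY of `Λ` is abc-iut-L5-t14's Heisenberg surjectivity
(`exists_commutator_mul_of_mem_commutatorClosure`: every `k ∈ K₂` is `ι[σ, y]·k₃`, `y ∈ Δ^tp_Y`, `k₃ ∈ K₃`,
under `hYab := dtpYTheta_comm hO` (abc-iut-L2-t8) and `hYcl`); MULTIPLICATIVITY is class-two bilinearity
(`ClassTwo.mk_commutator_mul_right`).  INJECTIVITY (the new part, no `hYcl` needed): if `[ι σ, ι y] ∈ K₃`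
then `ι y` is CENTRAL in `Δ_X` modulo `K₃` — it commutes mod `K₃` with `ι σ` and with `ι Δ^tp_Y`
(`commutator_toHat_mem_tripleCommutatorClosure`, abc-iut-L2-t8), hence with the dense `ι Δ^tp_X ⊆ (ι σ)^ℤ·ι Δ^tp_Y`;
testing on the finite Heisenberg quotients `Δ_X → H(ℤ/n)`, `a ↦ x`, `b ↦ y` (freeness), whose centre maps
to `1` in `(ℤ/n)²`, shows that `ι y` dies under EVERY continuous `Δ_X → (ℤ/n)²`, `a ↦ e₁`, `b ↦ e₂`; and an
element of a profinite group dying under all such pair-characters lies in the closed normal subgroup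
`K₂ ⊇ [Δ_X, Δ_X]` (separation by an open normal subgroup, Mathlib
`ProfiniteGrp.exist_openNormalSubgroup_sub_open_nhds_of_one`, and the uniqueness clause of freeness).
HONEST FRAMING: [EtTh] is refereed; the theta setting is data quoting print and is not asserted to exist;
this is OUR kernel check of the GROUP STRUCTURE of the printed "`≅ Ẑ(1)`" (the Tate twist "(1)" is NOT
claimed); `hYcl` stays an explicit hypothesis (not derivable from `Setting.lean` v3); nothing here bears
on [IUTchIII] Cor. 3.12 (the consumer `CoreTower` lies outside its cone); typed ≠ proved elsewhere.
-/

noncomputable section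

namespace Literature.AnabelianGeometry.EtaleTheta

open Literature.AnabelianGeometry.SemiGraphs Literature.Algebra.Homology Literature.Topology.FourManifolds
open _root_.Topology
open scoped commutatorElement
open CategoryTheory ClassTwo groupCohomology ProfiniteGrp ProfiniteGrp.ProfiniteCompletion

/-! ### Generic plumbing: the finite Heisenberg test group with its abelian projection, and separation of
a closed normal subgroup containing the commutators by pair-characters `→ (ℤ/n)²` -/

namespace DtpYEllAux

/-- **The level-`n` Heisenberg test group with its projection to `(ℤ/n)²`** ("the well-known structure of
the theta-group", [EtTh] p. 45): a finite group `H` of nilpotency class two with elements `x, y` and a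
homomorphism `pr : H → (ℤ/n)²`, `x ↦ e₁`, `y ↦ e₂`, such that every element commuting with `x` and `y`
dies under `pr` (the centre of `H(ℤ/n)` is the commutator line). [cite: MochizukiEtTh2009, Prop 2.12 p.45] -/
theorem exists_classTwo_center_test (n : ℕ) [NeZero n] :
    ∃ (H : Type) (_ : Group H) (_ : Finite H) (x y : H) (pr : H →* Multiplicative (ZMod n × ZMod n)),
      pr x = Multiplicative.ofAdd ((1 : ZMod n), (0 : ZMod n)) ∧
      pr y = Multiplicative.ofAdd ((0 : ZMod n), (1 : ZMod n)) ∧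
      (∀ q ∈ (⁅⁅(⊤ : Subgroup H), (⊤ : Subgroup H)⁆, (⊤ : Subgroup H)⁆ : Subgroup H), q = 1) ∧
      ∀ q : H, Commute q x → Commute q y → pr q = 1 := by
  let B : (ZMod n × ZMod n) →+ (ZMod n × ZMod n) →+ ZMod n :=
    { toFun := fun v =>
        { toFun := fun w => v.1 * w.2
          map_zero' := by simp
          map_add' := fun w w' => by simp only [Prod.snd_add, mul_add] }
      map_zero' := AddMonoidHom.ext fun w => by simp
      map_add' := fun v v' => AddMonoidHom.ext fun w => by
        simp only [AddMonoidHom.coe_mk, ZeroHom.coe_mk, AddMonoidHom.add_apply, Prod.fst_add,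
          add_mul] }
  obtain ⟨f, hf⟩ := exists_cocycles₂_of_biadditive B
  haveI : Finite (Rep.trivial (ZMod n) (Multiplicative (ZMod n × ZMod n)) (ZMod n)) :=
    inferInstanceAs (Finite (ZMod n))
  let x : CocycleExtension f := ⟨0, Multiplicative.ofAdd (1, 0)⟩
  let y : CocycleExtension f := ⟨0, Multiplicative.ofAdd (0, 1)⟩
  -- commutators in `E_f` are central
  have hQ1 : ∀ q ∈ (⁅(⊤ : Subgroup (CocycleExtension f)), (⊤ : Subgroup (CocycleExtension f))⁆ :
      Subgroup (CocycleExtension f)), ∃ c₀, q = CocycleExtension.inl f c₀ := by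
    intro q hq
    have hle : (⁅(⊤ : Subgroup (CocycleExtension f)), (⊤ : Subgroup (CocycleExtension f))⁆ :
        Subgroup (CocycleExtension f)) ≤ (CocycleExtension.rightHom f).ker := by
      rw [← commutator_def]
      exact Abelianization.commutator_subset_ker _
    have hq' := hle hq
    rw [← CocycleExtension.range_inl_eq_ker_rightHom] at hq'
    obtain ⟨c₀, hc₀⟩ := hq'
    exact ⟨c₀, hc₀.symm⟩
  have hcentral : ∀ (c₀) (q : CocycleExtension f), Commute (CocycleExtension.inl f c₀) q := by
    intro c₀ q
    have h := CocycleExtension.mul_inl_mul_inv f q c₀.toAdd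
    rw [Rep.trivial_ρ_apply, ofAdd_toAdd] at h
    exact (mul_inv_eq_iff_eq_mul.mp h).symm
  have hQ3 : ∀ q ∈ (⁅⁅(⊤ : Subgroup (CocycleExtension f)), (⊤ : Subgroup (CocycleExtension f))⁆,
      (⊤ : Subgroup (CocycleExtension f))⁆ : Subgroup (CocycleExtension f)), q = 1 := by
    have hle : (⁅⁅(⊤ : Subgroup (CocycleExtension f)), (⊤ : Subgroup (CocycleExtension f))⁆,
        (⊤ : Subgroup (CocycleExtension f))⁆ : Subgroup (CocycleExtension f)) ≤ ⊥ := by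
      refine Subgroup.commutator_le.mpr fun c₀ hc₀ q _ => ?_
      obtain ⟨c₁, rfl⟩ := hQ1 c₀ hc₀
      rw [Subgroup.mem_bot, commutatorElement_eq_one_iff_commute]
      exact hcentral c₁ q
    exact fun q hq => (Subgroup.mem_bot).mp (hle hq)
  -- the centre dies under `rightHom`
  have hkey : ∀ q z : CocycleExtension f, Commute q z →
      f (q.right, z.right) - f (z.right, q.right) = 0 := by
    intro q z hqz
    have h1 : q * z * q⁻¹ * z⁻¹ = 1 := by rw [hqz.eq]; group
    rw [CocycleExtension.commutator_eq_inl_of_trivial f q z (Commute.all _ _)] at h1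
    have h2 : Multiplicative.ofAdd (f (q.right, z.right) - f (z.right, q.right)) = 1 :=
      CocycleExtension.inl_injective f (h1.trans (map_one _).symm)
    exact ofAdd_eq_one.mp h2
  have hcenter : ∀ q : CocycleExtension f, Commute q x → Commute q y →
      CocycleExtension.rightHom f q = 1 := by
    intro q hqx hqy
    have hx' := hkey q x hqx
    have hy' := hkey q y hqy
    rw [hf, hf] at hx' hy'
    simp only [x, y, toAdd_ofAdd, B, AddMonoidHom.coe_mk, ZeroHom.coe_mk, mul_one, mul_zero,
      one_mul, zero_mul, zero_sub, sub_zero, neg_eq_zero] at hx' hy'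
    rw [CocycleExtension.rightHom_apply]
    have hq0 : q.right.toAdd = 0 := Prod.ext hy' hx'
    rwa [toAdd_eq_zero] at hq0
  exact ⟨CocycleExtension f, inferInstance, inferInstance, x, y, CocycleExtension.rightHom f, rfl, rfl,
    hQ3, hcenter⟩

/-- **Separation by pair-characters.**  Let `G` be a profinite group, `K ≤ G` a CLOSED normal subgroup
containing `[G, G]`, and `a, b ∈ G` a free topological pair (every pair of elements of a finite discrete
group is the image of `(a, b)` under a unique continuous homomorphism).  If `g ∈ G` dies under every
continuous homomorphism `G → (ℤ/n)²` with `a ↦ e₁`, `b ↦ e₂` (`n ≥ 1`), then `g ∈ K`: otherwise an open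
normal `N` with `g ∉ N·K` gives a finite abelian quotient `G/(N·K)`, generated by the images of `a, b`,
which receives `(ℤ/n)²` (`n` its order) compatibly with `(a, b)` — uniqueness then forces `g ∈ N·K`.
(Classical; plumbing for "`(Δ^tp_Y)^ell ≅ Ẑ(1)`".) [cite: MochizukiEtTh2009, §1 p.13] -/
theorem mem_of_forall_pairCharacter {G : Type} [Group G] [TopologicalSpace G] [IsTopologicalGroup G]
    [CompactSpace G] [TotallyDisconnectedSpace G] {K : Subgroup G} [K.Normal]
    (hK : IsClosed (K : Set G)) (hcomm : ⁅(⊤ : Subgroup G), (⊤ : Subgroup G)⁆ ≤ K) {a b : G}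
    (huniv : ∀ (Q : Type) [Group Q] [Finite Q] [TopologicalSpace Q] [DiscreteTopology Q]
      (x y : Q), ∃! f : G →ₜ* Q, f a = x ∧ f b = y)
    {g : G}
    (h : ∀ (n : ℕ) [NeZero n] (F : G →ₜ* Multiplicative (ZMod n × ZMod n)),
      F a = Multiplicative.ofAdd ((1 : ZMod n), (0 : ZMod n)) →
      F b = Multiplicative.ofAdd ((0 : ZMod n), (1 : ZMod n)) → F g = 1) :
    g ∈ K := by
  by_contra hgK
  -- an open normal subgroup `N` with `g ∉ N·K`
  let O : Set G := (fun x : G => x⁻¹ * g) ⁻¹' (K : Set G)ᶜ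
  have hOo : IsOpen O := hK.isOpen_compl.preimage (by fun_prop)
  have h1O : (1 : G) ∈ O := by
    change (1 : G)⁻¹ * g ∈ (K : Set G)ᶜ
    rw [inv_one, one_mul]
    exact hgK
  obtain ⟨N, hN⟩ := ProfiniteGrp.exist_openNormalSubgroup_sub_open_nhds_of_one hOo h1O
  let M : Subgroup G := N.toSubgroup ⊔ K
  haveI hMn : M.Normal := Subgroup.sup_normal _ _
  have hgM : g ∉ M := by
    intro hg
    have hg' : g ∈ ((N.toSubgroup ⊔ K : Subgroup G) : Set G) := hg
    rw [Subgroup.normal_mul] at hg'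
    obtain ⟨m, hm, k, hk, hmk⟩ := Set.mem_mul.mp hg'
    have hmO : m ∈ O := hN hm
    apply hmO
    change m⁻¹ * g ∈ (K : Set G)
    rw [← hmk, inv_mul_cancel_left]
    exact hk
  have hMo : IsOpen (M : Set G) := Subgroup.isOpen_mono le_sup_left N.toOpenSubgroup.isOpen
  -- the finite discrete quotient `Q = G/M`, commutative since `[G, G] ≤ K ≤ M`
  haveI : DiscreteTopology (G ⧸ M) := QuotientGroup.discreteTopology hMo
  haveI : Finite (G ⧸ M) := Subgroup.quotient_finite_of_isOpen M hMo
  have hQcomm : ∀ u v : G ⧸ M, u * v = v * u := by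
    intro u v
    obtain ⟨u, rfl⟩ := QuotientGroup.mk_surjective u
    obtain ⟨v, rfl⟩ := QuotientGroup.mk_surjective v
    rw [← commutatorElement_eq_one_iff_mul_comm]
    change ⁅QuotientGroup.mk' M u, QuotientGroup.mk' M v⁆ = 1
    rw [← map_commutatorElement, QuotientGroup.mk'_apply, QuotientGroup.eq_one_iff]
    exact (le_sup_right : K ≤ M)
      (hcomm (Subgroup.commutator_mem_commutator (Subgroup.mem_top u) (Subgroup.mem_top v)))
  -- its order `n₀`, and the images `ā`, `b̄`
  set n₀ : ℕ := Nat.card (G ⧸ M) with hn₀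
  haveI : NeZero n₀ := ⟨Nat.card_pos.ne'⟩
  set abar : G ⧸ M := QuotientGroup.mk a with habar
  set bbar : G ⧸ M := QuotientGroup.mk b with hbbar
  -- `ℓ₁ : ℤ/n₀ → Q`, `1 ↦ ā` and `ℓ₂ : ℤ/n₀ → Q`, `1 ↦ b̄`
  have hpow : ∀ c : G ⧸ M, (zmultiplesHom (Additive (G ⧸ M)) (Additive.ofMul c)) (n₀ : ℤ) = 0 := by
    intro c
    rw [zmultiplesHom_apply, natCast_zsmul]
    change Additive.ofMul (c ^ n₀) = 0
    rw [pow_card_eq_one']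
    rfl
  -- `ZMod.lift` of `1 ↦ c̄` evaluated at `1`
  have hlift1 : ∀ c : G ⧸ M,
      Additive.toMul ((ZMod.lift n₀ ⟨zmultiplesHom (Additive (G ⧸ M)) (Additive.ofMul c), hpow c⟩)
        (1 : ZMod n₀)) = c := by
    intro c
    have h1 : ((1 : ℤ) : ZMod n₀) = 1 := Int.cast_one
    rw [← h1, ZMod.lift_coe]
    change Additive.toMul ((zmultiplesHom (Additive (G ⧸ M)) (Additive.ofMul c)) 1) = c
    rw [zmultiplesHom_apply, one_zsmul]
    rfl
  let ℓ₁ : Multiplicative (ZMod n₀) →* G ⧸ M :=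
    AddMonoidHom.toMultiplicativeLeft
      (ZMod.lift n₀ ⟨zmultiplesHom (Additive (G ⧸ M)) (Additive.ofMul abar), hpow abar⟩)
  let ℓ₂ : Multiplicative (ZMod n₀) →* G ⧸ M :=
    AddMonoidHom.toMultiplicativeLeft
      (ZMod.lift n₀ ⟨zmultiplesHom (Additive (G ⧸ M)) (Additive.ofMul bbar), hpow bbar⟩)
  have hℓ₁ : ℓ₁ (Multiplicative.ofAdd 1) = abar := by
    simp only [ℓ₁, AddMonoidHom.coe_toMultiplicativeLeft, Function.comp_apply, toAdd_ofAdd]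
    exact hlift1 abar
  have hℓ₂ : ℓ₂ (Multiplicative.ofAdd 1) = bbar := by
    simp only [ℓ₂, AddMonoidHom.coe_toMultiplicativeLeft, Function.comp_apply, toAdd_ofAdd]
    exact hlift1 bbar
  -- `ℓ : (ℤ/n₀)² → Q`, `(u, v) ↦ ℓ₁ u · ℓ₂ v` (a homomorphism because `Q` is commutative)
  let ℓ : Multiplicative (ZMod n₀ × ZMod n₀) →* G ⧸ M :=
    { toFun := fun v => ℓ₁ (Multiplicative.ofAdd v.toAdd.1) * ℓ₂ (Multiplicative.ofAdd v.toAdd.2)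
      map_one' := by
        simp only [toAdd_one, Prod.fst_zero, Prod.snd_zero, ofAdd_zero, map_one, mul_one]
      map_mul' := fun v w => by
        simp only [toAdd_mul, Prod.fst_add, Prod.snd_add, ofAdd_add, map_mul]
        rw [mul_assoc, ← mul_assoc (ℓ₁ (Multiplicative.ofAdd w.toAdd.1)),
          hQcomm (ℓ₁ (Multiplicative.ofAdd w.toAdd.1)) (ℓ₂ (Multiplicative.ofAdd v.toAdd.2)),
          mul_assoc, ← mul_assoc] }
  have hℓa : ℓ (Multiplicative.ofAdd ((1 : ZMod n₀), (0 : ZMod n₀))) = abar := by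
    change ℓ₁ (Multiplicative.ofAdd 1) * ℓ₂ (Multiplicative.ofAdd 0) = abar
    rw [ofAdd_zero, map_one ℓ₂, mul_one, hℓ₁]
  have hℓb : ℓ (Multiplicative.ofAdd ((0 : ZMod n₀), (1 : ZMod n₀))) = bbar := by
    change ℓ₁ (Multiplicative.ofAdd 0) * ℓ₂ (Multiplicative.ofAdd 1) = bbar
    rw [ofAdd_zero, map_one ℓ₁, one_mul, hℓ₂]
  -- the pair-character of level `n₀`
  obtain ⟨F, ⟨hFa, hFb⟩, -⟩ := huniv (Multiplicative (ZMod n₀ × ZMod n₀))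
    (Multiplicative.ofAdd ((1 : ZMod n₀), (0 : ZMod n₀))) (Multiplicative.ofAdd ((0 : ZMod n₀), (1 : ZMod n₀)))
  -- two continuous homomorphisms `G → Q` agreeing on `a, b`: the projection and `ℓ ∘ F`
  let π : G →ₜ* G ⧸ M :=
    { toMonoidHom := QuotientGroup.mk' M, continuous_toFun := QuotientGroup.continuous_mk }
  have hℓc : Continuous ℓ := continuous_of_discreteTopology
  let ψ : G →ₜ* G ⧸ M :=
    { toMonoidHom := ℓ.comp F.toMonoidHom
      continuous_toFun := hℓc.comp F.continuous_toFun }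
  obtain ⟨f₀, -, huniq⟩ := huniv (G ⧸ M) abar bbar
  have hπ : π = f₀ := huniq π ⟨rfl, rfl⟩
  have hψ : ψ = f₀ := by
    refine huniq ψ ⟨?_, ?_⟩
    · change ℓ (F a) = abar
      rw [hFa, hℓa]
    · change ℓ (F b) = bbar
      rw [hFb, hℓb]
  have hg1 : π g = ψ g := by rw [hπ, hψ]
  have hFg : F g = 1 := h n₀ F hFa hFb
  have hπg : (QuotientGroup.mk g : G ⧸ M) = 1 := by
    change π g = 1
    rw [hg1]
    change ℓ (F g) = 1
    rw [hFg, map_one]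
  exact hgM ((QuotientGroup.eq_one_iff g).mp hπg)

end DtpYEllAux

/-! ### The theta setting -/

namespace ThetaSetting

open DtpYEllAux

variable {p : ℕ} [Fact p.Prime] (D : ThetaSetting p)

/-- **Non-degeneracy of the commutator pairing `(Δ_X/Δ_Y) × Δ^ell_Y → Δ_Θ`** ([EtTh] pp. 12–13;
[IUTchII] Rmk. 1.1.1 (iii)): under the freeness guard, for `σ ∈ Δ^tp_X` mapping to the generator `1` of
`Z = Δ^tp_X/Δ^tp_Y` and `y ∈ Δ^tp_Y`, if the commutator `[ι σ, ι y]` lies in `[[Δ_X,Δ_X],Δ_X]⁻` then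
`ι y ∈ [Δ_X,Δ_X]⁻`, i.e. `y` has trivial image in `(Π^tp_X)^ell`.  See the module docstring for the proof
(centrality modulo `K₃`, finite Heisenberg quotients, separation by pair-characters).
[cite: MochizukiEtTh2009, §1 p.13] -/
theorem IsEtThOrigin.toHat_mem_commutatorClosure_of_commutator_mem (hO : D.IsEtThOrigin)
    {σ : D.PiTemp} (hσ : σ ∈ D.DeltaTemp) (hσZ : D.toZ σ = Multiplicative.ofAdd 1)
    {y : D.PiTemp} (hy : y ∈ D.DtpY)
    (h : ⁅D.toHat.toMonoidHom σ, D.toHat.toMonoidHom y⁆ ∈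
      (⁅⁅D.DeltaHat, D.DeltaHat⁆, D.DeltaHat⁆).topologicalClosure) :
    D.toHat.toMonoidHom y ∈ (⁅D.DeltaHat, D.DeltaHat⁆).topologicalClosure := by
  classical
  haveI : CompactSpace D.PiHat := D.isProfiniteCompletion_toHat.compactSpace
  haveI : T2Space D.PiHat := D.isProfiniteCompletion_toHat.t2Space
  haveI hΔn : D.DeltaHat.Normal := SettingCompletion.deltaHat_normal D.toTemperedCurve
  set K₂ : Subgroup D.PiHat := (⁅D.DeltaHat, D.DeltaHat⁆).topologicalClosure with hK₂def
  set K₃ : Subgroup D.PiHat := (⁅⁅D.DeltaHat, D.DeltaHat⁆, D.DeltaHat⁆).topologicalClosure with hK₃def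
  have hK₂closed : IsClosed (K₂ : Set D.PiHat) := Subgroup.isClosed_topologicalClosure _
  have hΔclosed : IsClosed (D.DeltaHat : Set D.PiHat) := Subgroup.isClosed_topologicalClosure _
  -- membership of `ι`-images in `Δ_X`
  have hιΔ : ∀ {t : D.PiTemp}, t ∈ D.DeltaTemp → D.toHat.toMonoidHom t ∈ D.DeltaHat := by
    intro t ht
    have : t ∈ D.DeltaHat.comap D.toHat.toMonoidHom := by
      rw [SettingCompletion.comap_deltaHat D.toTemperedCurve]; exact ht
    exact this
  have hyΔ : y ∈ D.DeltaTemp := (inf_le_right : D.DtpY ≤ D.DeltaTemp) hy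
  -- the free pair, topologically generating `Δ_X`
  obtain ⟨hcpt, ht2, htd, -⟩ := hO.deltaHat_free
  haveI : CompactSpace D.DeltaHat := hcpt
  haveI : T2Space D.DeltaHat := ht2
  haveI : TotallyDisconnectedSpace D.DeltaHat := htd
  obtain ⟨a, b, huniv, -⟩ := hO.exists_topologicalGenerators
  -- the element `g = ι y ∈ Δ_X` and `τ = ι σ ∈ Δ_X`
  set g : D.DeltaHat := ⟨D.toHat.toMonoidHom y, hιΔ hyΔ⟩ with hgdef
  set τ : D.DeltaHat := ⟨D.toHat.toMonoidHom σ, hιΔ hσ⟩ with hτdef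
  -- `K₂ ∩ Δ_X` as a closed normal subgroup of `Δ_X` containing the commutators
  haveI hK₂n : K₂.Normal := Subgroup.is_normal_topologicalClosure _
  haveI : (K₂.subgroupOf D.DeltaHat).Normal := inferInstance
  have hKc : IsClosed ((K₂.subgroupOf D.DeltaHat : Subgroup D.DeltaHat) : Set D.DeltaHat) :=
    hK₂closed.preimage continuous_subtype_val
  have hKcomm : ⁅(⊤ : Subgroup D.DeltaHat), (⊤ : Subgroup D.DeltaHat)⁆ ≤ K₂.subgroupOf D.DeltaHat := by
    refine Subgroup.commutator_le.mpr fun u _ v _ => ?_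
    rw [Subgroup.mem_subgroupOf]
    have hc : ((⁅u, v⁆ : D.DeltaHat) : D.PiHat) = ⁅(u : D.PiHat), (v : D.PiHat)⁆ := by
      simp only [commutatorElement_def, Subgroup.coe_mul, Subgroup.coe_inv]
    rw [hc]
    exact Subgroup.le_topologicalClosure _ (Subgroup.commutator_mem_commutator u.2 v.2)
  -- it suffices to kill `g` under every pair-character `Δ_X → (ℤ/n)²`
  suffices hmem : g ∈ K₂.subgroupOf D.DeltaHat by
    rw [Subgroup.mem_subgroupOf] at hmem
    exact hmem
  refine mem_of_forall_pairCharacter hKc hKcomm huniv fun n _ F hFa hFb => ?_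
  -- the Heisenberg test group of level `n` and `F^H : Δ_X → H`, `a ↦ x`, `b ↦ y`
  obtain ⟨H, hHgrp, hHfin, x₀, y₀, pr, hprx, hpry, hQ3, hcenter⟩ := exists_classTwo_center_test n
  letI : Group H := hHgrp
  haveI : Finite H := hHfin
  letI : TopologicalSpace H := ⊥
  haveI : DiscreteTopology H := ⟨rfl⟩
  obtain ⟨FH, ⟨hFHa, hFHb⟩, -⟩ := huniv H x₀ y₀
  have hFHc : Continuous FH.toMonoidHom := FH.continuous_toFun
  -- `pr ∘ F^H = F` (uniqueness of the freeness against `(ℤ/n)²`)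
  have hprF : ∀ t : D.DeltaHat, pr (FH t) = F t := by
    obtain ⟨F₀, -, huniq⟩ := huniv (Multiplicative (ZMod n × ZMod n))
      (Multiplicative.ofAdd ((1 : ZMod n), (0 : ZMod n))) (Multiplicative.ofAdd ((0 : ZMod n), (1 : ZMod n)))
    have hprc : Continuous pr := continuous_of_discreteTopology
    let P : D.DeltaHat →ₜ* Multiplicative (ZMod n × ZMod n) :=
      { toMonoidHom := pr.comp FH.toMonoidHom
        continuous_toFun := hprc.comp FH.continuous_toFun }
    have hP : P = F₀ := by
      refine huniq P ⟨?_, ?_⟩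
      · change pr (FH a) = _
        rw [hFHa, hprx]
      · change pr (FH b) = _
        rw [hFHb, hpry]
    have hF : F = F₀ := huniq F ⟨hFa, hFb⟩
    intro t
    change P t = F t
    rw [hP, hF]
  -- `F^H` kills `K₂`'s commutators with `Δ_X`, i.e. `K₃`
  have hF2 : ∀ t : D.DeltaHat, (t : D.PiHat) ∈ K₂ →
      FH.toMonoidHom t ∈ (⁅(⊤ : Subgroup H), (⊤ : Subgroup H)⁆ : Subgroup H) := by
    have h2 : K₂ ≤ ((⁅(⊤ : Subgroup H), (⊤ : Subgroup H)⁆ : Subgroup H).comap FH.toMonoidHom).map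
        D.DeltaHat.subtype := by
      refine Subgroup.topologicalClosure_minimal _ (Subgroup.commutator_le.mpr ?_)
        (isClosed_map_subtype_comap hΔclosed FH.toMonoidHom hFHc _)
      intro g₁ hg₁ g₂ hg₂
      refine ⟨⁅(⟨g₁, hg₁⟩ : D.DeltaHat), ⟨g₂, hg₂⟩⁆, ?_, rfl⟩
      rw [SetLike.mem_coe, Subgroup.mem_comap, map_commutatorElement]
      exact Subgroup.commutator_mem_commutator (Subgroup.mem_top (FH.toMonoidHom ⟨g₁, hg₁⟩))
        (Subgroup.mem_top (FH.toMonoidHom ⟨g₂, hg₂⟩))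
    exact fun t ht => mem_of_coe_mem_map_subtype_comap FH.toMonoidHom _ (h2 ht)
  have hF3 : ∀ t : D.DeltaHat, (t : D.PiHat) ∈ K₃ → FH.toMonoidHom t = 1 := by
    have h3 : K₃ ≤ ((⁅⁅(⊤ : Subgroup H), (⊤ : Subgroup H)⁆, (⊤ : Subgroup H)⁆ : Subgroup H).comap
        FH.toMonoidHom).map D.DeltaHat.subtype := by
      refine Subgroup.topologicalClosure_minimal _ (Subgroup.commutator_le.mpr ?_)
        (isClosed_map_subtype_comap hΔclosed FH.toMonoidHom hFHc _)
      intro c₀ hc₀ g' hg'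
      have hc₀' : c₀ ∈ D.DeltaHat :=
        D.commutatorClosure_le_deltaHat (Subgroup.le_topologicalClosure _ hc₀)
      refine ⟨⁅(⟨c₀, hc₀'⟩ : D.DeltaHat), ⟨g', hg'⟩⁆, ?_, rfl⟩
      rw [SetLike.mem_coe, Subgroup.mem_comap, map_commutatorElement]
      exact Subgroup.commutator_mem_commutator
        (hF2 ⟨c₀, hc₀'⟩ (Subgroup.le_topologicalClosure _ hc₀)) (Subgroup.mem_top (FH.toMonoidHom ⟨g', hg'⟩))
    intro t ht
    exact hQ3 _ (mem_of_coe_mem_map_subtype_comap FH.toMonoidHom _ (h3 ht))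
  -- the elements of `Δ_X` whose `F^H`-image commutes with `F^H g` form a closed subgroup `C` of `Π_X` …
  let C : Subgroup D.PiHat :=
    ((Subgroup.centralizer ({FH.toMonoidHom g} : Set H)).comap FH.toMonoidHom).map D.DeltaHat.subtype
  have hCclosed : IsClosed (C : Set D.PiHat) :=
    isClosed_map_subtype_comap hΔclosed FH.toMonoidHom hFHc _
  have hC_of : ∀ t : D.DeltaHat, FH.toMonoidHom (t * g * t⁻¹ * g⁻¹) = 1 → (t : D.PiHat) ∈ C := by
    intro t ht
    refine ⟨t, ?_, rfl⟩
    rw [SetLike.mem_coe, Subgroup.mem_comap, Subgroup.mem_centralizer_iff]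
    intro h' hh'
    rw [Set.mem_singleton_iff] at hh'
    subst hh'
    rw [map_mul, map_mul, map_mul, map_inv, map_inv, ← commutatorElement_def,
      commutatorElement_eq_one_iff_mul_comm] at ht
    exact ht.symm
  -- … containing `τ = ι σ` (the hypothesis `[ι σ, ι y] ∈ K₃`) …
  have hτC : (τ : D.PiHat) ∈ C := by
    refine hC_of τ (hF3 _ ?_)
    simp only [Subgroup.coe_mul, Subgroup.coe_inv, hτdef, hgdef]
    rw [← commutatorElement_def]
    exact h
  -- … and `ι Δ^tp_Y` (`(Δ^tp_Y)^Θ` is abelian: abc-iut-L2-t8) …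
  have hYC : ∀ y' ∈ D.DtpY, D.toHat.toMonoidHom y' ∈ C := by
    intro y' hy'
    have hy'Δ : y' ∈ D.DeltaTemp := (inf_le_right : D.DtpY ≤ D.DeltaTemp) hy'
    refine hC_of ⟨D.toHat.toMonoidHom y', hιΔ hy'Δ⟩ (hF3 _ ?_)
    simp only [Subgroup.coe_mul, Subgroup.coe_inv, hgdef]
    rw [← commutatorElement_def]
    exact D.commutator_toHat_mem_tripleCommutatorClosure hO hy' hy
  -- … hence `ι Δ^tp_X ⊆ (ι σ)^ℤ · ι Δ^tp_Y` and, `C` being closed, all of `Δ_X`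
  have hΔC : D.DeltaHat ≤ C := by
    change (D.DeltaTemp.map D.toHat.toMonoidHom).topologicalClosure ≤ C
    refine Subgroup.topologicalClosure_minimal _ ?_ hCclosed
    rintro _ ⟨t, ht, rfl⟩
    obtain ⟨i, u, hu, rfl⟩ := D.exists_eq_zpow_mul_of_mem_deltaTemp hσ hσZ ht
    rw [map_mul, map_zpow]
    exact C.mul_mem (C.zpow_mem hτC i) (hYC u hu)
  have hcomm_of_C : ∀ t : D.DeltaHat, (t : D.PiHat) ∈ C → Commute (FH.toMonoidHom g) (FH.toMonoidHom t) := by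
    intro t ht
    have hmem := mem_of_coe_mem_map_subtype_comap FH.toMonoidHom _ ht
    rw [Subgroup.mem_centralizer_iff] at hmem
    exact (hmem _ (Set.mem_singleton _))
  have hx : Commute (FH g) x₀ := by
    rw [← hFHa]
    exact hcomm_of_C a (hΔC a.2)
  have hy₀ : Commute (FH g) y₀ := by
    rw [← hFHb]
    exact hcomm_of_C b (hΔC b.2)
  rw [← hprF g]
  exact hcenter (FH g) hx hy₀

/-- **`(Δ^tp_Y)^ell ≅ Ẑ`, homomorphism form** ([EtTh] p. 13 "`(Δ^tp_Y)^ell ≅ Ẑ(1)`"): under the freeness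
guard `IsEtThOrigin` and the closedness binder `hYcl` ("(Δ^tp_Y)^Θ is profinite", pp. 12–13; GAP-LEDGER
G-w4d021-2), there is a SURJECTIVE homomorphism `Λ : Δ^tp_Y → Ẑ` whose kernel is exactly
`Δ^tp_Y ∩ Ker(Π^tp_X ↠ (Π^tp_X)^ell)` — the commutator pairing `y ↦ [ι σ, ι y]` with a generator `σ` of
`Z`, read in `[Δ_X,Δ_X]⁻/[[Δ_X,Δ_X],Δ_X]⁻ ≅ Ẑ`. [cite: MochizukiEtTh2009, §1 p.13] -/
theorem IsEtThOrigin.exists_hom_dtpY_zHat (hO : D.IsEtThOrigin)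
    (hYcl : (D.DtpY.map D.toHat.toMonoidHom).topologicalClosure ≤
      D.DtpY.map D.toHat.toMonoidHom ⊔ (⁅⁅D.DeltaHat, D.DeltaHat⁆, D.DeltaHat⁆).topologicalClosure) :
    ∃ Λ : ↥D.DtpY →* ZHat, Function.Surjective Λ ∧
      ∀ y : ↥D.DtpY, Λ y = 1 ↔ (y : D.PiTemp) ∈ (D.thetaToEll.comp D.toTheta).ker := by
  classical
  haveI : CompactSpace D.PiHat := D.isProfiniteCompletion_toHat.compactSpace
  haveI : T2Space D.PiHat := D.isProfiniteCompletion_toHat.t2Space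
  haveI hΔn : D.DeltaHat.Normal := SettingCompletion.deltaHat_normal D.toTemperedCurve
  haveI hK₃n : (⁅⁅D.DeltaHat, D.DeltaHat⁆, D.DeltaHat⁆).topologicalClosure.Normal :=
    Subgroup.is_normal_topologicalClosure _
  set K₂ : Subgroup D.PiHat := (⁅D.DeltaHat, D.DeltaHat⁆).topologicalClosure with hK₂def
  set K₃ : Subgroup D.PiHat := (⁅⁅D.DeltaHat, D.DeltaHat⁆, D.DeltaHat⁆).topologicalClosure with hK₃def
  -- class-two data `A = Δ_X ⊇ K₂ ⊇ K₃`
  have hAA : ⁅D.DeltaHat, D.DeltaHat⁆ ≤ K₂ := Subgroup.le_topologicalClosure _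
  have hAK : ⁅D.DeltaHat, K₂⁆ ≤ K₃ := by
    refine (commutator_topologicalClosure_right_le _ _).trans (le_of_eq ?_)
    rw [Subgroup.commutator_comm D.DeltaHat ⁅D.DeltaHat, D.DeltaHat⁆]
  have hK₃₂ : K₃ ≤ K₂ := Subgroup.topologicalClosure_mono (Subgroup.commutator_le_left _ _)
  have hιΔ : ∀ {t : D.PiTemp}, t ∈ D.DeltaTemp → D.toHat.toMonoidHom t ∈ D.DeltaHat := by
    intro t ht
    have : t ∈ D.DeltaHat.comap D.toHat.toMonoidHom := by
      rw [SettingCompletion.comap_deltaHat D.toTemperedCurve]; exact ht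
    exact this
  -- a generator `σ` of `Z = Δ^tp_X/Δ^tp_Y`
  obtain ⟨⟨σ, hσ⟩, hσZ'⟩ := D.toZ_delta_surjective (Multiplicative.ofAdd 1)
  have hσZ : D.toZ σ = Multiplicative.ofAdd 1 := hσZ'
  -- abc-iut-w5-d171's `φ : K₂ ↠ Ẑ` with kernel `K₃`
  obtain ⟨a, b, φ, -, hφs, hφk, -⟩ := hO.exists_hom_commutatorClosure_zHat
  have hφcongr : ∀ u v : ↥K₂, ((u : D.PiHat) : D.PiHat ⧸ K₃) = (v : D.PiHat) → φ u = φ v := by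
    intro u v huv
    rw [QuotientGroup.eq] at huv
    have h1 : φ (u⁻¹ * v) = 1 := (hφk (u⁻¹ * v)).mpr (by
      rw [Subgroup.coe_mul, Subgroup.coe_inv]; exact huv)
    rwa [map_mul, map_inv, inv_mul_eq_one] at h1
  -- the pairing `y ↦ [ι σ, ι y] ∈ K₂`
  have hcmem : ∀ y : ↥D.DtpY, ⁅D.toHat.toMonoidHom σ, D.toHat.toMonoidHom (y : D.PiTemp)⁆ ∈ K₂ := fun y =>
    hAA (Subgroup.commutator_mem_commutator (hιΔ hσ)
      (hιΔ ((inf_le_right : D.DtpY ≤ D.DeltaTemp) y.2)))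
  let c : ↥D.DtpY → ↥K₂ := fun y => ⟨⁅D.toHat.toMonoidHom σ, D.toHat.toMonoidHom (y : D.PiTemp)⁆, hcmem y⟩
  have hc : ∀ y : ↥D.DtpY, (c y : D.PiHat) = ⁅D.toHat.toMonoidHom σ, D.toHat.toMonoidHom (y : D.PiTemp)⁆ :=
    fun y => rfl
  let Λ : ↥D.DtpY →* ZHat :=
    { toFun := fun y => φ (c y)
      map_one' := by
        have h1 : c 1 = 1 := Subtype.ext (by
          rw [hc, OneMemClass.coe_one, map_one, commutatorElement_one_right, OneMemClass.coe_one])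
        rw [h1, map_one]
      map_mul' := fun y y' => by
        rw [← map_mul]
        refine hφcongr _ _ ?_
        rw [hc, Subgroup.coe_mul, map_mul, Subgroup.coe_mul, hc, hc, QuotientGroup.mk_mul]
        exact mk_commutator_mul_right D.DeltaHat K₂ K₃ hAA hAK (hιΔ hσ)
          (hιΔ ((inf_le_right : D.DtpY ≤ D.DeltaTemp) y.2))
          (hιΔ ((inf_le_right : D.DtpY ≤ D.DeltaTemp) y'.2)) }
  have hΛ : ∀ y, Λ y = φ (c y) := fun y => rfl
  refine ⟨Λ, ?_, fun y => ?_⟩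
  · -- surjectivity: Heisenberg surjectivity (abc-iut-L5-t14) under `hYab` (abc-iut-L2-t8) and `hYcl`
    intro t
    obtain ⟨k, rfl⟩ := hφs t
    obtain ⟨y, hy, k₃, hk₃, hkeq⟩ := D.exists_commutator_mul_of_mem_commutatorClosure
      (D.dtpYTheta_comm hO) hYcl hσ hσZ k.2
    refine ⟨⟨y, hy⟩, ?_⟩
    rw [hΛ]
    refine hφcongr _ _ ?_
    rw [hc, hkeq, ← commutatorElement_def, map_commutatorElement, QuotientGroup.mk_mul,
      (QuotientGroup.eq_one_iff k₃).mpr hk₃, mul_one]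
  · -- kernel: `[ι σ, ι y] ∈ K₃ ↔ ι y ∈ K₂ ↔ y ∈ Ker(Π^tp_X ↠ (Π^tp_X)^ell)`
    rw [hΛ, hφk, hc, D.ker_toEll, Subgroup.mem_comap]
    constructor
    · exact hO.toHat_mem_commutatorClosure_of_commutator_mem D hσ hσZ y.2
    · intro hyK
      exact hAK (Subgroup.commutator_mem_commutator (hιΔ hσ) hyK)

/-- **`Δ^tp_Y / (Δ^tp_Y ∩ Ker(Π^tp_X ↠ (Π^tp_X)^ell)) ≅ Ẑ`** ([EtTh] p. 13 "`(Δ^tp_Y)^ell ≅ Ẑ(1)`"; the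
`kerEll`/`deltaEll_iso` shape of [IUTchII] Rmk. 1.1.1 (i), "`Π^ell_Y(M)` [isomorphic to `Ẑ(1) ⋊ G_k`]"),
under `IsEtThOrigin` and the closedness binder `hYcl`. [cite: MochizukiEtTh2009, §1 p.13] -/
theorem IsEtThOrigin.nonempty_dtpY_quotient_mulEquiv_zHat (hO : D.IsEtThOrigin)
    (hYcl : (D.DtpY.map D.toHat.toMonoidHom).topologicalClosure ≤
      D.DtpY.map D.toHat.toMonoidHom ⊔ (⁅⁅D.DeltaHat, D.DeltaHat⁆, D.DeltaHat⁆).topologicalClosure) :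
    Nonempty (↥D.DtpY ⧸ ((D.thetaToEll.comp D.toTheta).ker.subgroupOf D.DtpY) ≃* ZHat) := by
  obtain ⟨Λ, hΛs, hΛk⟩ := hO.exists_hom_dtpY_zHat D hYcl
  have hkerEq : Λ.ker = (D.thetaToEll.comp D.toTheta).ker.subgroupOf D.DtpY := by
    ext y
    rw [MonoidHom.mem_ker, hΛk y, Subgroup.mem_subgroupOf]
  exact ⟨(QuotientGroup.quotientMulEquivOfEq hkerEq).symm.trans
    (QuotientGroup.quotientKerEquivOfSurjective Λ hΛs)⟩

/-- **`(Δ^tp_Y)^ell ≅ Ẑ`** for the printed object "`(Δ^tp_Y)^ell`, the image of `Δ^tp_Y` in `(Π^tp_X)^ell`"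
([EtTh] p. 12; "`(Δ^tp_Y)^ell ≅ Ẑ(1)`", p. 13) — as an ABSTRACT GROUP (the Tate twist is not claimed), under
`IsEtThOrigin` and the closedness binder `hYcl`. [cite: MochizukiEtTh2009, §1 p.13] -/
theorem IsEtThOrigin.nonempty_dtpYEll_mulEquiv_zHat (hO : D.IsEtThOrigin)
    (hYcl : (D.DtpY.map D.toHat.toMonoidHom).topologicalClosure ≤
      D.DtpY.map D.toHat.toMonoidHom ⊔ (⁅⁅D.DeltaHat, D.DeltaHat⁆, D.DeltaHat⁆).topologicalClosure) :
    Nonempty (↥(D.DtpY.map (D.thetaToEll.comp D.toTheta)) ≃* ZHat) := by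
  obtain ⟨e⟩ := hO.nonempty_dtpY_quotient_mulEquiv_zHat D hYcl
  let f : ↥D.DtpY →* D.GtpEll := (D.thetaToEll.comp D.toTheta).comp D.DtpY.subtype
  have hker : f.ker = (D.thetaToEll.comp D.toTheta).ker.subgroupOf D.DtpY := by
    ext y
    rw [MonoidHom.mem_ker, Subgroup.mem_subgroupOf, MonoidHom.mem_ker]
    rfl
  have hrange : f.range = D.DtpY.map (D.thetaToEll.comp D.toTheta) := by
    rw [MonoidHom.range_comp, Subgroup.range_subtype]
  exact ⟨(MulEquiv.subgroupCongr hrange).symm.trans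
    ((QuotientGroup.quotientKerEquivRange f).symm.trans
      ((QuotientGroup.quotientMulEquivOfEq hker).trans e))⟩

end ThetaSetting

end Literature.AnabelianGeometry.EtaleTheta

end
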